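import Summits.QuantumFields.YangMills.Theorems.BalabanUVNodesN21RoadIAtN16LoosePinnedReading

/-!
# N21 (NE7c) · (t-N16b) — THE LETTER SQUEEZE AND THE RADIUS FLOOR THAT N19′'s LINK READING FORCES AT K3⁷ v5's LOOSE PIN
# (`2^76·L^12·b ≤ ε`, `B ≥ 2^78·L^12`, `g ≤ gradConst 4 (2^-76·L^-12·ε)`), AN INDEPENDENCE WITNESS AGAINST v5's KEY ROWS, AND THE END-RECIPE MISS

Width seat `pub-ymgap-dag-n21-w6` (g2), node N21 = NE7c (NOT PRINTED in [Bałaban 1983–89], NOT proved), dag-lead WIDTH-209 N21 PIECE 3 (t-N16b)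
«THE END's radius FLOOR ∕ the `4ε₁ ≤ c'` guard row LOCATED + typed at the record as a tree lemma for the N21 ∕ N19 consumer», crux K3⁷
`SpineGivenEndpointR13SepCoPH` (stmt-QuantumFields-20544; `--kind proof --supports … --as helper`, count-neutral).  THEOREMS ONLY: 0 `def`, 0 `sorry`,
standard axioms.  Consumes BY NAME: v5's tree mirror `…K3V5Defs` (`GuardedReadingN16`, `N16RadiusMatch`), module 43 `…N16PinnedLayer13CoPH`
(`N16PinnedLoose`, `N16LettersEnd`), `…N16HolderRegime` (`InEndRegimeH`, `radiusOfRecordH`, `constOfRecordH`), and this seat's g0 file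
`…N21RoadIAtN16LoosePinnedReading` (`rateCarriers_ne3_eq_of_pinnedLoose`, `roadI_signs_of_n16LettersEnd`).  Nothing edited.

THE LOCATED QUESTION.  Node N19's link reading — every edition of the dag-n19-w3 lineage: tuning-window `…N19RateEdgeHolderD4AtTuningWindow` :183–186,
N16-pinned `…AtN16PinnedReading` :196–199, pinned `…AtPinnedReading` :154–157 (p609283), keyed `…AtKeyedReading` (p611389) and the by-name storey
`…N19KeyedCoreEdgeHolderD4KeyedK3V5` (INTENT-7′(b)) — DISPLAYS, in its (v′-16) block, node N16's `NE3Shape` thresholds (`…N16Shape` §3 :240, the radii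
`b, c ≤ t` with `2^91·L^17·t ≤ 1`, `2^76·L^12·t ≤ ε`) together with the (t-N16b) guard row, at the carrier `R := rateCarriersOfRecord₁₃CoPH 𝔯 F θ hP g₀ os k`:
`R.ne3.b ≤ t`, `c' ≤ t`, `2^76·(R.ne3.L)^12·t ≤ R.ne3.ε`, `4·((ℓ₃ F).ε ∕ B F) ≤ c'`, and `R.ne3.g = gradConst 4 c'`, `0 ≤ c'`.
Under v5's loose pin `N16PinnedLoose 𝔯 ℓ₃ B` the carrier's letters ARE THE END's: `R.ne3.ε = (ℓ₃ F).ε`, `R.ne3.b = (ℓ₃ F).b`, `R.ne3.g = (ℓ₃ F).g`,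
`R.ne3.L = F.L` (g0 file §1).  This file records what those rows then say about THE END's letters and the loose radius — in kernel, numbers not adjectives:
* §1  (pure real arithmetic) `squeeze_of_rows`: the four rows force `2^76·L^12·b ≤ ε` and `2^78·L^12·(ε∕B) ≤ ε`; `floor_of_rows`: with `0 < ε`, `0 < B`
  they force `2^78·L^12 ≤ B`; `looseRadius_le_of_rows`: `ε∕B ≤ ε∕(2^78·L^12)`; `gRow_of_rows`: `g = gradConst 4 c'`, `0 ≤ c' ≤ t` force
  `g ≤ gradConst 4 (ε∕(2^76·L^12))`; `rows_solvable_iff`: the `t`-rows are solvable iff `2^91·L^17·max b c' ≤ 1 ∧ 2^76·L^12·max b c' ≤ ε`;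
  `rows_solvable_of_squeeze_floor`: conversely the squeeze + the floor (+ `2^15·L^5·ε ≤ 1`) make the whole radii block solvable — they ARE its content.
* §2  (at the loose-pinned reading, N-generic; then v5's key BY NAME, `N = 2`) `letters_squeeze_of_pinnedLoose`, `gRow_of_pinnedLoose`,
  ★ `radiusFloor_of_guardedReadingN16`: at EVERY tuple ∕ run length where N19′'s displayed rows hold, `2^78·(F.L)^12 ≤ B F` (and `F.L ≥ 12`, so
  `B F ≥ 2^78·12^12 > 10^36`), `2^76·(F.L)^12·(ℓ₃ F).b ≤ (ℓ₃ F).ε`, and the loose data radius satisfies `(ℓ₃ F).ε ∕ B F ≤ (ℓ₃ F).ε ∕ (2^78·(F.L)^12)`.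
* §3  ★ `exists_lettersEnd_radiusMatch_not_squeeze` — INDEPENDENCE WITNESS: for every coupling letter `g > 0` there are EXPLICIT `ℓ₃, B` satisfying v5's two
  scalar N16 key rows `N16LettersEnd 2 g ℓ₃ ∧ N16RadiusMatch ℓ₃ B` (with `b = ε∕2`, `B = 2`) at which BOTH forced rows FAIL for every family — v5's key does
  NOT carry the squeeze or the floor; a consumer of `GuardedReadingN16` cannot derive them; a non-vacuous N19′ storey needs them DISPLAYED (key-side or
  producer-side).
* §4  `not_squeeze_of_endRecipe`: THE END's letter recipe of record (dag-n16-w1 `…N16AtRecord13OfEdges.exists_window_letters_linearLeaf` :86,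
  `b := min (ε∕2) (1∕(512·5·8·L²))`, feeding module 45's producer `…N16PinnedLooseMatch` §2 with `B F := max (C F).B₃ ((ℓ₃ F).ε∕(ℓ₃ F).b)`), read as a
  HYPOTHESIS on `(ε, b)`, together with N19's own row `1024·5·8·L²·ε ≤ 1`, VIOLATES `2^76·L^12·b ≤ ε` (`L ≥ 1`).  So at letters following that recipe
  N19′'s (v′-16) block is uninhabitable; the window lemma's closers take no hypothesis on `b` beyond `0 < b ≤ min (ε∕2) (…)`, so a smaller `b` is free
  on N16's side — the row with content is the `c'`∕`g` row (regularity ∝ DATA radius `ε∕B`, not ∝ class radius `ε`).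

WORDS OF RECORD.  plan g84 WORDS-1 (C) (pub-ymgap INBOX l.30362): «v5 STANDS; a K3 cut only on the N19′ consumer's naming line; producers please pin `B`
print-side in the re-keyed edition» — §2 ★ is that pin's NUMBER; dag-n19-w3 g3 census `N19-LINK-READING-CENSUS-w3g3.md` («(t-N16b): the row stays
displayed»).  This file proves NO registered stub and edits no skeleton.

HONEST FRAMING.  [bookkeeping] real arithmetic over DISPLAYED hypothesis rows, two `rfl`-level letter identifications under the pin, and one explicit
letters witness; every N19′ row is a HYPOTHESIS here exactly as in the n19 files (0 ∕ 1 inhabited); nothing of Bałaban's is asserted or instantiated;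
NE3 ∕ NE7 ∕ NE7c NOT PRINTED ∕ NOT proved; **N16 ∕ N19 ∕ N21 NOT discharged**; K3⁷ OPEN, NOT claimed, its skeleton of record (v5 941dddb108cbaacf) NOT
edited; counts UNMOVED (typed 28∕28 · discharged 5∕27, A 5∕28); one finite 𝕋⁴ programme at fixed ε — R4 would close only the CONDITIONAL finite-𝕋⁴
rung `BalabanLadder.UV`; NOT ℝ⁴ ∕ continuum ∕ OS ∕ mass gap.  The Yang–Mills mass gap (Clay) is NOT proved by any of this.
-/

set_option autoImplicit false

namespace Summit.QuantumFields.YangMills.Theorems.N21N16bSqueezeAtN19Rows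

open Literature.MathematicalPhysics.QuantumFieldTheory.Balaban1983to89
open Literature.MathematicalPhysics.QuantumFieldTheory.Balaban1983to89.T4Continuum (T4Family ULoop)
open Summit.QuantumFields.BalabanUV.T4Continuum
open MinimalActionRefine (gradConst gradConst_mono)
open Node00 (Stage13HParams NE3Letters₁₁ ne3ConstLayerOfRecord₁₁ ne3NperOfRecord₁₁ ne3DomOfRecord₁₁ one_le_ne3NperOfRecord₁₁)
open YMDAG.UVSplit (RateReading₁₃CoPH rateCarriersOfRecord₁₃CoPH ne3OfRecord₁₁)
open Summit.QuantumFields.YangMills.BalabanUVNodes.N16HolderRegime (InEndRegimeH radiusOfRecordH constOfRecordH radiusOfRecordH_pos)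
open Summit.QuantumFields.YangMills.BalabanUVNodes.N16PinnedLayer13CoPH (N16PinnedLoose N16LettersEnd)
open Summit.QuantumFields.YangMills.Theorems.K3V5Defs (RunSel LetterReading N16RadiusMatch GuardedReadingN16)
open Summit.QuantumFields.YangMills.Theorems.N21RoadIAtN16LoosePinnedReading (rateCarriers_ne3_eq_of_pinnedLoose roadI_signs_of_n16LettersEnd)

noncomputable section

/-! ## §1 The displayed rows, pure real arithmetic -/

section Scalar

variable {ε b B c t L g : ℝ}

/-- **THE SQUEEZE, SCALAR FORM**: the rows `b ≤ t`, `c ≤ t`, `2^76·L^12·t ≤ ε` and the (t-N16b) guard row `4·(ε∕B) ≤ c` force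
`2^76·L^12·b ≤ ε` and `2^78·L^12·(ε∕B) ≤ ε` (no sign hypothesis on `ε`, `B`, `L`: the power is even). [bookkeeping] -/
theorem squeeze_of_rows (hbt : b ≤ t) (hct : c ≤ t) (hεt : (2 : ℝ) ^ 76 * L ^ 12 * t ≤ ε) (hc : 4 * (ε / B) ≤ c) :
    (2 : ℝ) ^ 76 * L ^ 12 * b ≤ ε ∧ (2 : ℝ) ^ 78 * L ^ 12 * (ε / B) ≤ ε := by
  have hK : 0 ≤ (2 : ℝ) ^ 76 * L ^ 12 := by positivity
  refine ⟨(mul_le_mul_of_nonneg_left hbt hK).trans hεt, ?_⟩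
  calc (2 : ℝ) ^ 78 * L ^ 12 * (ε / B) = (2 : ℝ) ^ 76 * L ^ 12 * (4 * (ε / B)) := by ring
    _ ≤ (2 : ℝ) ^ 76 * L ^ 12 * c := mul_le_mul_of_nonneg_left hc hK
    _ ≤ (2 : ℝ) ^ 76 * L ^ 12 * t := mul_le_mul_of_nonneg_left hct hK
    _ ≤ ε := hεt

/-- **THE RADIUS FLOOR, SCALAR FORM**: with `0 < ε` and `0 < B`, the rows `c ≤ t`, `2^76·L^12·t ≤ ε`, `4·(ε∕B) ≤ c` force `2^78·L^12 ≤ B`. [bookkeeping] -/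
theorem floor_of_rows (hε : 0 < ε) (hB : 0 < B) (hct : c ≤ t) (hεt : (2 : ℝ) ^ 76 * L ^ 12 * t ≤ ε) (hc : 4 * (ε / B) ≤ c) :
    (2 : ℝ) ^ 78 * L ^ 12 ≤ B := by
  have h := (squeeze_of_rows hct hct hεt hc).2
  rw [mul_div_assoc', div_le_iff₀ hB] at h
  exact le_of_mul_le_mul_right (h.trans_eq (mul_comm ε B)) hε

/-- **THE LOOSE RADIUS UNDER THE FLOOR**: with `0 < L`, the same rows force `ε∕B ≤ ε∕(2^78·L^12)`. [bookkeeping] -/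
theorem looseRadius_le_of_rows (hL : 0 < L) (hct : c ≤ t) (hεt : (2 : ℝ) ^ 76 * L ^ 12 * t ≤ ε) (hc : 4 * (ε / B) ≤ c) :
    ε / B ≤ ε / ((2 : ℝ) ^ 78 * L ^ 12) := by
  have h := (squeeze_of_rows hct hct hεt hc).2
  rw [le_div_iff₀ (by positivity)]
  linarith [mul_comm ((2 : ℝ) ^ 78 * L ^ 12) (ε / B)]

/-- **THE COUPLING-LETTER ROW, SCALAR FORM**: `g = gradConst 4 c` (`= 4·#Plane(4)·c²`), `0 ≤ c ≤ t` and `2^76·L^12·t ≤ ε` (`L > 0`) force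
`g ≤ gradConst 4 (ε∕(2^76·L^12))` (`gradConst_mono`). [bookkeeping] -/
theorem gRow_of_rows (hL : 0 < L) (hg : g = gradConst 4 c) (hc0 : 0 ≤ c) (hct : c ≤ t) (hεt : (2 : ℝ) ^ 76 * L ^ 12 * t ≤ ε) :
    g ≤ gradConst 4 (ε / ((2 : ℝ) ^ 76 * L ^ 12)) := by
  have hK : 0 < (2 : ℝ) ^ 76 * L ^ 12 := by positivity
  have hcle : c ≤ ε / ((2 : ℝ) ^ 76 * L ^ 12) := by
    rw [le_div_iff₀ hK]
    calc c * ((2 : ℝ) ^ 76 * L ^ 12) ≤ t * ((2 : ℝ) ^ 76 * L ^ 12) := mul_le_mul_of_nonneg_right hct hK.le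
      _ = (2 : ℝ) ^ 76 * L ^ 12 * t := mul_comm _ _
      _ ≤ ε := hεt
  rw [hg]
  exact gradConst_mono hc0 hcle

/-- **SOLVABILITY OF THE `t`-ROWS** at given radii `b`, `c` (`L ≥ 0`): `∃ t, b ≤ t ∧ c ≤ t ∧ 2^91·L^17·t ≤ 1 ∧ 2^76·L^12·t ≤ ε` iff
`2^91·L^17·max b c ≤ 1 ∧ 2^76·L^12·max b c ≤ ε` (take `t := max b c`). [bookkeeping] -/
theorem rows_solvable_iff (hL : 0 ≤ L) :
    (∃ t : ℝ, b ≤ t ∧ c ≤ t ∧ (2 : ℝ) ^ 91 * L ^ 17 * t ≤ 1 ∧ (2 : ℝ) ^ 76 * L ^ 12 * t ≤ ε) ↔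
      (2 : ℝ) ^ 91 * L ^ 17 * max b c ≤ 1 ∧ (2 : ℝ) ^ 76 * L ^ 12 * max b c ≤ ε := by
  constructor
  · rintro ⟨t, hbt, hct, h1, h2⟩
    have hm : max b c ≤ t := max_le hbt hct
    exact ⟨(mul_le_mul_of_nonneg_left hm (by positivity)).trans h1, (mul_le_mul_of_nonneg_left hm (by positivity)).trans h2⟩
  · rintro ⟨h1, h2⟩
    exact ⟨max b c, le_max_left _ _, le_max_right _ _, h1, h2⟩

/-- **THE FORCED ROWS ARE ALSO SUFFICIENT (vacuity guard of the repair)**: if `0 < L`, `0 ≤ ε`, N19's numeral regime `2^15·L^5·ε ≤ 1`, the squeeze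
`2^76·L^12·b ≤ ε` and the floor `2^78·L^12 ≤ B` hold, then the four displayed rows together with `2^91·L^17·t ≤ 1` and `0 ≤ c` ARE solvable in
`(c, t)` — take `c := t := ε∕(2^76·L^12)`.  (The coupling letter is then read off as `g = gradConst 4 c`.)  So §1's two rows are exactly the scalar
content of N19′'s (v′-16) radii block at the loose pin: necessary (`squeeze_of_rows`, `floor_of_rows`) and sufficient. [bookkeeping] -/
theorem rows_solvable_of_squeeze_floor (hL : 0 < L) (hε : 0 ≤ ε) (hεs : (2 : ℝ) ^ 15 * L ^ 5 * ε ≤ 1)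
    (hb : (2 : ℝ) ^ 76 * L ^ 12 * b ≤ ε) (hB : (2 : ℝ) ^ 78 * L ^ 12 ≤ B) :
    ∃ c t : ℝ, 0 ≤ c ∧ b ≤ t ∧ c ≤ t ∧ (2 : ℝ) ^ 91 * L ^ 17 * t ≤ 1 ∧ (2 : ℝ) ^ 76 * L ^ 12 * t ≤ ε ∧ 4 * (ε / B) ≤ c := by
  have hK : 0 < (2 : ℝ) ^ 76 * L ^ 12 := by positivity
  have hB0 : 0 < B := lt_of_lt_of_le (by positivity) hB
  refine ⟨ε / ((2 : ℝ) ^ 76 * L ^ 12), ε / ((2 : ℝ) ^ 76 * L ^ 12), div_nonneg hε hK.le, ?_, le_rfl, ?_, ?_, ?_⟩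
  · rw [le_div_iff₀ hK]; linarith [mul_comm b ((2 : ℝ) ^ 76 * L ^ 12)]
  · calc (2 : ℝ) ^ 91 * L ^ 17 * (ε / ((2 : ℝ) ^ 76 * L ^ 12)) = (2 : ℝ) ^ 15 * L ^ 5 * ε := by field_simp
      _ ≤ 1 := hεs
  · rw [mul_div_cancel₀ _ hK.ne']
  · -- `4·(ε∕B) ≤ ε∕(2^76·L^12)` iff `4·ε·(2^76·L^12) ≤ ε·B`, from the floor and `0 ≤ ε`
    rw [mul_div_assoc', div_le_div_iff₀ hB0 hK]
    calc 4 * ε * ((2 : ℝ) ^ 76 * L ^ 12) = ε * ((2 : ℝ) ^ 78 * L ^ 12) := by ring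
      _ ≤ ε * B := mul_le_mul_of_nonneg_left hB hε

end Scalar

/-! ## §2 At the loose-pinned reading: the rows read THE END's letters; v5's key BY NAME gives the floor -/

section Reading

variable {N : ℕ} [NeZero N] {𝔯 : RateReading₁₃CoPH N} {ℓ₃ : T4Family → NE3Letters₁₁} {B : T4Family → ℝ}

/-- **THE SQUEEZE AT THE LOOSE-PINNED READING** (N-generic): under `N16PinnedLoose 𝔯 ℓ₃ B`, at every Stage-13 tuple with core provisos and every run
length, IF N19′'s displayed rows `R.ne3.b ≤ t`, `c' ≤ t`, `2^76·(R.ne3.L)^12·t ≤ R.ne3.ε`, `4·((ℓ₃ F).ε ∕ B F) ≤ c'` hold at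
`R := rateCarriersOfRecord₁₃CoPH 𝔯 F θ hP g₀ os k` THEN `2^76·(F.L)^12·(ℓ₃ F).b ≤ (ℓ₃ F).ε` and `2^78·(F.L)^12·((ℓ₃ F).ε ∕ B F) ≤ (ℓ₃ F).ε`
(the carrier's letters are `ℓ₃ F`'s and its block factor is `F.L`, g0 file §1; then §1). [bookkeeping] -/
theorem letters_squeeze_of_pinnedLoose (h : N16PinnedLoose 𝔯 ℓ₃ B) (F : T4Family) (θ : Stage13HParams F N) (hP : θ.Provisos₁₃CoPH F N)
    (g₀ : ℕ → ℝ) (os : List (ULoop F)) (k : ℕ) {c' t : ℝ}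
    (hbt : (rateCarriersOfRecord₁₃CoPH 𝔯 F θ hP g₀ os k).ne3.b ≤ t) (hct : c' ≤ t)
    (hεt : (2 : ℝ) ^ 76 * ((rateCarriersOfRecord₁₃CoPH 𝔯 F θ hP g₀ os k).ne3.L : ℝ) ^ 12 * t ≤ (rateCarriersOfRecord₁₃CoPH 𝔯 F θ hP g₀ os k).ne3.ε)
    (hc : 4 * ((ℓ₃ F).ε / B F) ≤ c') :
    (2 : ℝ) ^ 76 * (F.L : ℝ) ^ 12 * (ℓ₃ F).b ≤ (ℓ₃ F).ε ∧ (2 : ℝ) ^ 78 * (F.L : ℝ) ^ 12 * ((ℓ₃ F).ε / B F) ≤ (ℓ₃ F).ε := by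
  rw [rateCarriers_ne3_eq_of_pinnedLoose h] at hbt hεt
  exact squeeze_of_rows hbt hct hεt hc

/-- **THE COUPLING-LETTER ROW AT THE LOOSE-PINNED READING** (N-generic): under the pin, N19′'s rows `R.ne3.g = gradConst 4 c'`, `0 ≤ c'`, `c' ≤ t`,
`2^76·(R.ne3.L)^12·t ≤ R.ne3.ε` force THE END's gradient ∕ coupling letter under `(ℓ₃ F).g ≤ gradConst 4 ((ℓ₃ F).ε ∕ (2^76·(F.L)^12))`. [bookkeeping] -/
theorem gRow_of_pinnedLoose (h : N16PinnedLoose 𝔯 ℓ₃ B) (F : T4Family) (θ : Stage13HParams F N) (hP : θ.Provisos₁₃CoPH F N)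
    (g₀ : ℕ → ℝ) (os : List (ULoop F)) (k : ℕ) {c' t : ℝ}
    (hg : (rateCarriersOfRecord₁₃CoPH 𝔯 F θ hP g₀ os k).ne3.g = gradConst 4 c') (hc0 : 0 ≤ c') (hct : c' ≤ t)
    (hεt : (2 : ℝ) ^ 76 * ((rateCarriersOfRecord₁₃CoPH 𝔯 F θ hP g₀ os k).ne3.L : ℝ) ^ 12 * t ≤ (rateCarriersOfRecord₁₃CoPH 𝔯 F θ hP g₀ os k).ne3.ε) :
    (ℓ₃ F).g ≤ gradConst 4 ((ℓ₃ F).ε / ((2 : ℝ) ^ 76 * (F.L : ℝ) ^ 12)) := by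
  rw [rateCarriers_ne3_eq_of_pinnedLoose h] at hg hεt
  have hL : (0 : ℝ) < F.L := by exact_mod_cast lt_of_lt_of_le (by norm_num) (HistoryFlow.two_le_L F)
  exact gRow_of_rows hL hg hc0 hct hεt

/-- ★ **THE RADIUS FLOOR AT K3⁷ v5's KEY, BY NAME** (`N = 2`): from `GuardedReadingN16 𝔯 ksel ℓ ℓ₃ g B` (its pin, THE END's row — whence
`0 < (ℓ₃ F).ε` — and the match row — whence `0 < B F`) and N19′'s four displayed rows at `rateCarriersOfRecord₁₃CoPH 𝔯 F θ hP g₀ os k`: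
`2^78·(F.L)^12 ≤ B F`, the numeral `2^78·12^12 ≤ B F` (`F.L ≥ 12`, [Balaban1987RG1] p. 251 «L > 11»), the squeeze `2^76·(F.L)^12·(ℓ₃ F).b ≤ (ℓ₃ F).ε`,
and the loose data radius bound `(ℓ₃ F).ε ∕ B F ≤ (ℓ₃ F).ε ∕ (2^78·(F.L)^12)`.  The pin plan g84 WORDS-1 (C) asks the producers for, as a number.
Every row is a HYPOTHESIS; nothing inhabited here. [bookkeeping] -/
theorem radiusFloor_of_guardedReadingN16 {𝔯 : RateReading₁₃CoPH 2} {ksel : RunSel} {ℓ : LetterReading} {ℓ₃ : T4Family → NE3Letters₁₁}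
    {g B : T4Family → ℝ} (hG : GuardedReadingN16 𝔯 ksel ℓ ℓ₃ g B)
    (F : T4Family) (θ : Stage13HParams F 2) (hP : θ.Provisos₁₃CoPH F 2) (g₀ : ℕ → ℝ) (os : List (ULoop F)) (k : ℕ) {c' t : ℝ}
    (hbt : (rateCarriersOfRecord₁₃CoPH 𝔯 F θ hP g₀ os k).ne3.b ≤ t) (hct : c' ≤ t)
    (hεt : (2 : ℝ) ^ 76 * ((rateCarriersOfRecord₁₃CoPH 𝔯 F θ hP g₀ os k).ne3.L : ℝ) ^ 12 * t ≤ (rateCarriersOfRecord₁₃CoPH 𝔯 F θ hP g₀ os k).ne3.ε)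
    (hc : 4 * ((ℓ₃ F).ε / B F) ≤ c') :
    (2 : ℝ) ^ 78 * (F.L : ℝ) ^ 12 ≤ B F ∧ (2 : ℝ) ^ 78 * (12 : ℝ) ^ 12 ≤ B F ∧
      (2 : ℝ) ^ 76 * (F.L : ℝ) ^ 12 * (ℓ₃ F).b ≤ (ℓ₃ F).ε ∧ (ℓ₃ F).ε / B F ≤ (ℓ₃ F).ε / ((2 : ℝ) ^ 78 * (F.L : ℝ) ^ 12) := by
  obtain ⟨-, hpin, hEnd, hmatch⟩ := hG
  have hε : 0 < (ℓ₃ F).ε := (roadI_signs_of_n16LettersEnd hEnd F).2.1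
  have hB : 0 < B F := (hmatch F).1
  have hL12 : (12 : ℝ) ≤ F.L := by exact_mod_cast F.hL11
  have hL : (0 : ℝ) < F.L := lt_of_lt_of_le (by norm_num) hL12
  rw [rateCarriers_ne3_eq_of_pinnedLoose hpin] at hbt hεt
  have hfloor : (2 : ℝ) ^ 78 * (F.L : ℝ) ^ 12 ≤ B F := floor_of_rows hε hB hct hεt hc
  refine ⟨hfloor, le_trans ?_ hfloor, (squeeze_of_rows hbt hct hεt hc).1, looseRadius_le_of_rows hL hct hεt hc⟩
  exact mul_le_mul_of_nonneg_left (pow_le_pow_left₀ (by norm_num) hL12 12) (by positivity)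

end Reading

/-! ## §3 v5's scalar N16 key rows do NOT carry the squeeze or the floor: an explicit letters witness -/

/-- ★ **INDEPENDENCE WITNESS**: for every coupling letter `g` with `0 < g F`, the EXPLICIT letters `ℓ₃ F := ⟨ε, ε∕2, g F, Cof_H, r_H, 1⟩` with
`r_H := radiusOfRecordH 2 F.L Nper₀`, `Cof_H := constOfRecordH 2 F.L Nper₀ (g F)`, `ε := min r_H (1∕(10240·(F.L)²))`, and the radius letter `B F := 2`
satisfy v5's two scalar N16 key rows `N16LettersEnd 2 g ℓ₃` (incl. THE END's regime `InEndRegimeH`, whose only row on `b` is `0 ≤ b ≤ ε∕2`) and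
`N16RadiusMatch ℓ₃ B`, yet at EVERY family BOTH rows N19′ forces FAIL: `¬ 2^76·(F.L)^12·b ≤ ε` and `¬ 2^78·(F.L)^12 ≤ B F`.  So no consumer of
`GuardedReadingN16` can derive them — they must be DISPLAYED. [bookkeeping] -/
theorem exists_lettersEnd_radiusMatch_not_squeeze (g : T4Family → ℝ) (hg : ∀ F, 0 < g F) :
    ∃ (ℓ₃ : T4Family → NE3Letters₁₁) (B : T4Family → ℝ), N16LettersEnd 2 g ℓ₃ ∧ N16RadiusMatch ℓ₃ B ∧
      ∀ F : T4Family, ¬ ((2 : ℝ) ^ 76 * (F.L : ℝ) ^ 12 * (ℓ₃ F).b ≤ (ℓ₃ F).ε) ∧ ¬ ((2 : ℝ) ^ 78 * (F.L : ℝ) ^ 12 ≤ B F) := by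
  -- per family: the radius of record, the class radius below it and below `1∕(10240 L²)`, `b := ε∕2`
  have hL2 : ∀ F : T4Family, 2 ≤ F.L := HistoryFlow.two_le_L
  have hN1 : ∀ F : T4Family, 1 ≤ ne3NperOfRecord₁₁ F 0 0 := fun F => one_le_ne3NperOfRecord₁₁ F 0 0
  have hr : ∀ F : T4Family, 0 < radiusOfRecordH 2 F.L (ne3NperOfRecord₁₁ F 0 0) := fun F => radiusOfRecordH_pos (hL2 F) (hN1 F)
  have hLpos : ∀ F : T4Family, (0 : ℝ) < F.L := fun F => by exact_mod_cast lt_of_lt_of_le (by norm_num) (hL2 F)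
  let ε : T4Family → ℝ := fun F => min (radiusOfRecordH 2 F.L (ne3NperOfRecord₁₁ F 0 0)) (1 / (10240 * (F.L : ℝ) ^ 2))
  have hε0 : ∀ F, 0 < ε F := fun F => lt_min (hr F) (by have := hLpos F; positivity)
  have hεr : ∀ F, ε F ≤ radiusOfRecordH 2 F.L (ne3NperOfRecord₁₁ F 0 0) := fun F => min_le_left _ _
  have hεs : ∀ F, ε F ≤ 1 / (10240 * (F.L : ℝ) ^ 2) := fun F => min_le_right _ _
  refine ⟨fun F => ⟨ε F, ε F / 2, g F, constOfRecordH 2 F.L (ne3NperOfRecord₁₁ F 0 0) (g F), radiusOfRecordH 2 F.L (ne3NperOfRecord₁₁ F 0 0), 1⟩,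
    fun _ => 2, fun F => ⟨rfl, rfl, rfl, by change 0 < ε F / 2; exact half_pos (hε0 F), ?_, one_pos, ?_⟩,
    fun F => ⟨two_pos, by change ε F / 2 ≤ ε F / 2; exact le_rfl⟩, fun F => ⟨?_, ?_⟩⟩
  · -- N21's numeral `512·5·8·L²·(ε∕2) ≤ 1` from `ε ≤ 1∕(10240 L²)`
    change 512 * (4 + 1) * (4 + 4) * (F.L : ℝ) ^ 2 * (ε F / 2) ≤ 1
    have h := hεs F
    have hL2' : (0 : ℝ) < 10240 * (F.L : ℝ) ^ 2 := by have := hLpos F; positivity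
    rw [le_div_iff₀ hL2'] at h
    nlinarith [h]
  · -- THE END's regime at the constant layer of record: every row by construction
    exact ⟨hL2 F, hN1 F, hg F, hε0 F, hεr F, (hr F).le, le_rfl, (half_pos (hε0 F)).le, le_rfl, le_rfl⟩
  · -- the squeeze fails at `b = ε∕2`: `2^76·L^12·(ε∕2) = 2^75·(L^12·ε) ≥ 2^75·ε > ε`
    change ¬ ((2 : ℝ) ^ 76 * (F.L : ℝ) ^ 12 * (ε F / 2) ≤ ε F)
    intro h
    have hL1 : (1 : ℝ) ≤ (F.L : ℝ) ^ 12 := one_le_pow₀ (by exact_mod_cast le_trans one_le_two (hL2 F))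
    have h1 : ε F ≤ (F.L : ℝ) ^ 12 * ε F := le_mul_of_one_le_left (hε0 F).le hL1
    have h2 : (2 : ℝ) ^ 76 * (F.L : ℝ) ^ 12 * (ε F / 2) = (2 : ℝ) ^ 75 * ((F.L : ℝ) ^ 12 * ε F) := by ring
    rw [h2] at h
    have h3 : (2 : ℝ) ^ 75 * ε F ≤ ε F := le_trans (mul_le_mul_of_nonneg_left h1 (by positivity)) h
    have h4 : 0 < ε F := hε0 F
    nlinarith [h3, h4]
  · -- the floor fails at `B = 2`: `2^78·L^12 ≥ 2^78 > 2`
    change ¬ ((2 : ℝ) ^ 78 * (F.L : ℝ) ^ 12 ≤ 2)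
    intro h
    have hL1 : (1 : ℝ) ≤ (F.L : ℝ) ^ 12 := one_le_pow₀ (by exact_mod_cast le_trans one_le_two (hL2 F))
    have h1 : (2 : ℝ) ^ 78 ≤ (2 : ℝ) ^ 78 * (F.L : ℝ) ^ 12 := le_mul_of_one_le_right (by positivity) hL1
    have h2 : (2 : ℝ) < (2 : ℝ) ^ 78 := by norm_num
    linarith

/-! ## §4 THE END's letter recipe of record misses the squeeze -/

/-- **THE END-RECIPE MISS**: letters following THE END's recipe of record — dag-n16-w1 `exists_window_letters_linearLeaf` (:86):
`b = min (ε∕2) (1∕(512·5·8·L²))` — read here as a HYPOTHESIS on `(ε, b)`, together with N19's own displayed row `1024·5·8·L²·ε ≤ 1` and `0 < ε`,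
`L ≥ 1`, VIOLATE the forced row `2^76·L^12·b ≤ ε`: in the first branch `2^76·L^12·(ε∕2) ≥ 2^75·ε > ε`, in the second `2^76·L^12∕(20480·L²) ≥ 2^76∕20480 > 1 ≥ ε`.
Hence at letters of that recipe N19′'s (v′-16) block is uninhabitable.  A statement about the recipe, not about any opaque witness. [bookkeeping] -/
theorem not_squeeze_of_endRecipe {L ε b : ℝ} (hL : 1 ≤ L) (hε : 0 < ε) (hεs : 1024 * (4 + 1) * (4 + 4) * L ^ 2 * ε ≤ 1)
    (hb : b = min (ε / 2) (1 / (512 * (4 + 1) * (4 + 4) * L ^ 2))) : ¬ ((2 : ℝ) ^ 76 * L ^ 12 * b ≤ ε) := by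
  intro h
  have hL12 : (1 : ℝ) ≤ L ^ 12 := one_le_pow₀ hL
  have hL2 : (1 : ℝ) ≤ L ^ 2 := one_le_pow₀ hL
  have hL10 : (1 : ℝ) ≤ L ^ 10 := one_le_pow₀ hL
  rcases le_total (ε / 2) (1 / (512 * (4 + 1) * (4 + 4) * L ^ 2)) with hle | hle
  · -- branch `b = ε∕2`
    rw [hb, min_eq_left hle] at h
    have h1 : ε ≤ L ^ 12 * ε := le_mul_of_one_le_left hε.le hL12
    have h2 : (2 : ℝ) ^ 76 * L ^ 12 * (ε / 2) = (2 : ℝ) ^ 75 * (L ^ 12 * ε) := by ring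
    rw [h2] at h
    have h3 : (2 : ℝ) ^ 75 * ε ≤ ε := le_trans (mul_le_mul_of_nonneg_left h1 (by positivity)) h
    nlinarith [h3, hε]
  · -- branch `b = 1∕(20480·L²)`: the left side is `2^76·L^10∕20480 ≥ 2^76∕20480 > 1`, while `ε ≤ 1`
    rw [hb, min_eq_right hle] at h
    have hK : (0 : ℝ) < 512 * (4 + 1) * (4 + 4) * L ^ 2 := by positivity
    have h1 : (2 : ℝ) ^ 76 * L ^ 12 * (1 / (512 * (4 + 1) * (4 + 4) * L ^ 2)) = (2 : ℝ) ^ 76 * L ^ 10 / 20480 := by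
      field_simp
      ring
    rw [h1] at h
    have h2 : (2 : ℝ) ^ 76 / 20480 ≤ (2 : ℝ) ^ 76 * L ^ 10 / 20480 := by
      rw [div_le_div_iff_of_pos_right (by norm_num : (0 : ℝ) < 20480)]
      exact le_mul_of_one_le_right (by positivity) hL10
    have h3 : ε ≤ 1 := by nlinarith [hεs, hL2, hε]
    have h4 : (1 : ℝ) < (2 : ℝ) ^ 76 / 20480 := by norm_num
    linarith

end

end Summit.QuantumFields.YangMills.Theorems.N21N16bSqueezeAtN19Rows
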